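import Mathlib
import Literature.Probability.Percolation.PercolationProofs
import Literature.Probability.LatticeModels.ProdBernoulliIndependence
import Literature.Probability.LatticeModels.ProdBernoulliClusterLocality
import Literature.Probability.Percolation.KozmaNitzanPinning
import Summits.CriticalPhenomena.PercolationContinuityZ3.Theorems.PercNearOneGluingAdditiveGluingSigmaRecursion
import HarnessLib

/-! # Crux `PercNearOneGluing.AdditiveGluing` (stmt-CriticalPhenomena-4576), line `subuniform-dead-pocket-maximum` — stub `stub_goodBase`

Helper file for the crux (skeleton `Cruxes/AdditiveGluing/Lines/subuniform-dead-pocket-maximum.lean`):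
the BASE CASE of the strong induction `good_all` — Kozma–Nitzan's "good quadruple" inequality
(arXiv:2401.12397 §3.2 p. 12, in the skeleton's linear selection form) for an observer `o`
ISOLATED in `G ∖ A` (every positive-weight non-loop pair at `o` goes into `A`), i.e. the class of
KN's Theorem 4 (pp. 12–14), DERIVED from KN's Lemma 5 in `σ_B`-form for an arbitrary relay, taken
as the displayed hypothesis `h5` (the neighbouring stub `stub_lemma5AnyRelay`).  Proves exactly the
registered stub signature `stub_goodBase`; lands with `--supports stmt-CriticalPhenomena-4576`.

Notation: `μ = prodBernoulli w`; `σ_∅ = {ω | ∀ y ≠ o, s(o,y) ∉ ω}` (no open non-loop pair at `o`);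
for `B ∌ o`, `σ_B = {ω | ∀ y ≠ o, s(o,y) ∈ ω ↔ y ∈ B}` (KN's `σ_B` = the fibre over `B` of the
open-star map `ω ↦ {y ≠ o | s(o,y) ∈ ω}`); `τ°(x) = μ(x ↔ b in {o}ᶜ)`; `C(o) = openCluster · o`.

Proof (KN, proof of Thm 4, pp. 13–14).  Let `a₀ ∈ A` minimise `τ°` over `A`.
* Termwise Lemma 5: for `B ≠ ∅`, `μ(σ_B ∩ {a₀ ↔ b}) ≤ μ(σ_B ∩ {o ↔ b})` — `h5` if `B` meets `A`
  at `v` (`τ°(a₀) ≤ τ°(v)`); if `B` avoids `A`, some `y ∈ B` has `w s(o,y) = 0` and `σ_B` is null.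
* Summing, with the `∅`-term `μ(σ_∅ ∩ {a₀ ↔ b}) = μ(σ_∅ ∩ {a₀ ↔ b in {o}ᶜ}) = μ(σ_∅) τ°(a₀)`
  (disjoint-support independence): `μ(a₀ ↔ b) ≤ μ(o ↔ b) + μ(σ_∅) τ°(a₀)`.
* Live failure: `{o ↔ b} ⊆ ⋃_{a ∈ A} {o ↔ a} ⊆ σ_∅ᶜ`, so
  `μ(o ↔ A, o ↮ b) = μ(o ↔ A) − μ(o ↔ b) ≤ (1 − μ σ_∅) − (1 − t) + μ(σ_∅) τ°(a₀)`.
* Penalty: a dead pocket `W ≠ {o}` is a null value of `C(o)` (its first open pair at `o` has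
  weight `0`), `{C(o) = {o}} ⊆ σ_∅`, and `1 − τ°(sel {o}) ≤ 1 − τ°(a₀)`: penalty
  `≤ μ(σ_∅)(1 − τ°(a₀))`, and the two bounds add up to `t`.  No new definitions. -/

namespace Summit.CriticalPhenomena.PercolationContinuityZ3.Theorems

open MeasureTheory Set
open Literature.Probability.LatticeModels (prodBernoulli)
open Literature.Probability.Percolation (BondConfig openConn openConnIn openGraph openCluster
  openGraph_adj DeterminedBy determinedBy_iff)
open scoped BigOperators

noncomputable section
open Classical

variable {n : ℕ}

/-- First step of an open path leaving `o`: if `o ↔ y` with `y ≠ o`, some non-loop pair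
`s(o, z)` is open, with `z` in the open cluster of `o`. [folklore] -/
theorem goodBase_exists_open_pair {ω : BondConfig (Fin n)} {o y : Fin n}
    (h : (openGraph ω).Reachable o y) (hy : y ≠ o) :
    ∃ z : Fin n, z ≠ o ∧ s(o, z) ∈ ω ∧ (openGraph ω).Reachable o z := by
  obtain ⟨p⟩ := h
  cases p with
  | nil => exact absurd rfl hy
  | cons hadj _ =>
    have h' := (openGraph_adj _ _ _).1 hadj
    exact ⟨_, fun h => h'.2 h.symm, h'.1, hadj.reachable⟩

/-- On `σ_∅` (no open non-loop pair at `o`) an open path between vertices other than `o` avoids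
`o`: `σ_∅ ∩ {a ↔ b} = σ_∅ ∩ {a ↔ b in {o}ᶜ}` for `a ≠ o`. [folklore] -/
theorem goodBase_isolated_inter_openConn (o a b : Fin n) (ha : a ≠ o) :
    {ω : BondConfig (Fin n) | ∀ y : Fin n, y ≠ o → s(o, y) ∉ ω} ∩ openConn a b =
      {ω : BondConfig (Fin n) | ∀ y : Fin n, y ≠ o → s(o, y) ∉ ω} ∩
        openConnIn (({o} : Set (Fin n))ᶜ) a b := by
  ext ω
  simp only [Set.mem_inter_iff, Set.mem_setOf_eq]
  refine ⟨fun h => ⟨h.1, ?_⟩, fun h => ⟨h.1, ?_⟩⟩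
  · obtain ⟨hE, hab⟩ := h
    apply Literature.Probability.Percolation.DCT16.mem_openConnIn_of_pathIn
    have hr : (openGraph ω).Reachable a b := hab
    clear hab
    rw [SimpleGraph.reachable_iff_reflTransGen] at hr
    refine ⟨Set.mem_compl_singleton_iff.2 ha, ?_⟩
    induction hr with
    | refl => exact Relation.ReflTransGen.refl
    | @tail x y _ hxy ih =>
      refine ih.tail ⟨hxy, Set.mem_compl_singleton_iff.2 fun hyo => ?_⟩
      have h' := (openGraph_adj _ _ _).1 hxy
      rw [hyo] at h'
      have hox : s(o, x) ∈ ω := by rw [Sym2.eq_swap]; exact h'.1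
      exact hE x h'.2 hox
  · exact Literature.Probability.Percolation.reachable_of_pathIn
      (Literature.Probability.Percolation.DCT16.pathIn_of_mem_openConnIn h.2)

/-- On `σ_∅` the observer reaches no other vertex: `⋃_{a ∈ A} {o ↔ a} ⊆ σ_∅ᶜ` when `o ∉ A`.
[folklore] -/
theorem goodBase_iUnion_subset_compl (A : Finset (Fin n)) (o : Fin n) (hoA : o ∉ A) :
    (⋃ a ∈ A, (openConn o a : Set (BondConfig (Fin n)))) ⊆
      {ω : BondConfig (Fin n) | ∀ y : Fin n, y ≠ o → s(o, y) ∉ ω}ᶜ := by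
  intro ω hω hE
  simp only [Set.mem_iUnion, exists_prop] at hω
  obtain ⟨a, haA, hωa⟩ := hω
  have hao : a ≠ o := fun h => hoA (h ▸ haA)
  obtain ⟨z, hzo, hz, -⟩ := goodBase_exists_open_pair hωa hao
  exact hE z hzo hz

/-- `{C(o) = {o}} ⊆ σ_∅`: an open non-loop pair at `o` puts a second vertex into `C(o)`.
[folklore] -/
theorem goodBase_cluster_singleton_subset (o : Fin n) :
    {ω : BondConfig (Fin n) | openCluster ω o = ((({o} : Finset (Fin n))) : Set (Fin n))} ⊆
      {ω : BondConfig (Fin n) | ∀ y : Fin n, y ≠ o → s(o, y) ∉ ω} := by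
  intro ω hω y hy hoy
  have hω' : openCluster ω o = ({o} : Set (Fin n)) := by
    rw [show openCluster ω o = _ from hω, Finset.coe_singleton]
  have hadj : (openGraph ω).Adj o y := (openGraph_adj ω o y).2 ⟨hoy, fun h => hy h.symm⟩
  have hyC : y ∈ openCluster ω o := hadj.reachable
  rw [hω', Set.mem_singleton_iff] at hyC
  exact hy hyC

/-- A dead pocket `W ∋ o` other than `{o}` is a null value of `C(o)` when every pair `s(o, y)`
with `y ∉ A`, `y ≠ o` has weight `0`: the first open pair of a path from `o` into `W ∖ {o}` ends
in `C(o) = W ⊆ Aᶜ`. [folklore] -/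
theorem goodBase_cluster_null (w : Sym2 (Fin n) → unitInterval) (A W : Finset (Fin n)) (o : Fin n)
    (hiso : ∀ y : Fin n, y ∉ A → y ≠ o → w s(o, y) = 0) (hWA : Disjoint W A) (hW : W ≠ {o})
    (hoW : o ∈ W) :
    (prodBernoulli w).real {ω : BondConfig (Fin n) | openCluster ω o = (W : Set (Fin n))} = 0 := by
  refine sigmaRec_null w _ ((W.filter fun z => z ≠ o).image fun z => s(o, z)) ?_ ?_
  · intro e he
    obtain ⟨z, hz, rfl⟩ := Finset.mem_image.1 he
    rw [Finset.mem_filter] at hz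
    exact hiso z (Finset.disjoint_left.1 hWA hz.1) hz.2
  · intro ω hω
    have hω' : openCluster ω o = (W : Set (Fin n)) := hω
    obtain ⟨y, hyW, hyo⟩ : ∃ y ∈ W, y ≠ o := by
      by_contra hcon
      push Not at hcon
      exact hW (Finset.eq_singleton_iff_unique_mem.2 ⟨hoW, hcon⟩)
    have hy : y ∈ openCluster ω o := by
      rw [hω']
      exact Finset.mem_coe.2 hyW
    obtain ⟨z, hzo, hz, hzr⟩ := goodBase_exists_open_pair hy hyo
    have hzW : z ∈ W := by
      have hzC : z ∈ openCluster ω o := hzr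
      rw [hω'] at hzC
      exact Finset.mem_coe.1 hzC
    exact ⟨s(o, z), Finset.mem_image.2 ⟨z, Finset.mem_filter.2 ⟨hzW, hzo⟩, rfl⟩, hz⟩

/-- `σ_∅` is determined by the pairs containing `o`. [folklore] -/
theorem goodBase_determinedBy_isolated (o : Fin n) :
    DeterminedBy {ω : BondConfig (Fin n) | ∀ y : Fin n, y ≠ o → s(o, y) ∉ ω}
      (↑(Finset.univ.filter fun e : Sym2 (Fin n) => o ∈ e) : Set (Sym2 (Fin n))) := by
  rw [determinedBy_iff]
  intro ω ω' h
  simp only [Set.mem_setOf_eq]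
  refine forall₂_congr fun y _ => not_congr ?_
  have he : s(o, y) ∈ (↑(Finset.univ.filter fun e : Sym2 (Fin n) => o ∈ e) : Set (Sym2 (Fin n))) := by
    rw [Finset.coe_filter]
    exact ⟨Finset.mem_univ _, Sym2.mem_mk_left o y⟩
  exact ⟨fun h1 => ((Set.ext_iff.1 h _).1 ⟨h1, he⟩).1, fun h1 => ((Set.ext_iff.1 h _).2 ⟨h1, he⟩).1⟩

/-- **`μ(σ_∅ ∩ {a ↔ b}) = μ(σ_∅) · τ°(a)`** for `a ≠ o`: on `σ_∅` the connection avoids `o`, and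
`σ_∅` (pairs at `o`) is independent of `{a ↔ b in {o}ᶜ}` (pairs off `o`). [folklore] -/
theorem goodBase_real_isolated_inter_openConn (w : Sym2 (Fin n) → unitInterval) (o a b : Fin n)
    (ha : a ≠ o) :
    (prodBernoulli w).real
        ({ω : BondConfig (Fin n) | ∀ y : Fin n, y ≠ o → s(o, y) ∉ ω} ∩ openConn a b) =
      (prodBernoulli w).real {ω : BondConfig (Fin n) | ∀ y : Fin n, y ≠ o → s(o, y) ∉ ω} *
        (prodBernoulli w).real (openConnIn (({o} : Set (Fin n))ᶜ) a b) := by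
  rw [goodBase_isolated_inter_openConn o a b ha]
  refine Literature.Probability.LatticeModels.prodBernoulli_real_inter_of_determinedBy w
    (Finset.univ.filter fun e : Sym2 (Fin n) => o ∈ e) (goodBase_determinedBy_isolated o) ?_
    (Set.toFinite _).measurableSet (Set.toFinite _).measurableSet
  refine Literature.Probability.Percolation.DCT16.determinedBy_openConnIn _ a b fun e he => ?_
  rw [Set.mem_compl_iff, Finset.coe_filter]
  rintro ⟨-, hoe⟩
  exact Set.mem_sym2_iff_subset.1 he hoe rfl

/-- The fibre of the open-star map `ω ↦ {y ≠ o | s(o,y) ∈ ω}` over `B ∌ o` is KN's event `σ_B`.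
[folklore] -/
theorem goodBase_fibre_eq (o : Fin n) (B : Finset (Fin n)) (hoB : o ∉ B) :
    (fun ω : BondConfig (Fin n) => Finset.univ.filter fun y : Fin n => y ≠ o ∧ s(o, y) ∈ ω) ⁻¹' {B} =
      {ω : BondConfig (Fin n) | ∀ y : Fin n, y ≠ o → (s(o, y) ∈ ω ↔ y ∈ B)} := by
  ext ω
  simp only [Set.mem_preimage, Set.mem_singleton_iff, Finset.ext_iff, Finset.mem_filter,
    Finset.mem_univ, true_and, Set.mem_setOf_eq]
  constructor
  · intro h y hy
    rw [← h y]
    exact ⟨fun hs => ⟨hy, hs⟩, fun h' => h'.2⟩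
  · intro h y
    constructor
    · rintro ⟨hy, hs⟩
      exact (h y hy).1 hs
    · intro hyB
      have hy : y ≠ o := fun h' => hoB (h' ▸ hyB)
      exact ⟨hy, (h y hy).2 hyB⟩

/-- Over `B ∋ o` the fibre of the open-star map is empty. [folklore] -/
theorem goodBase_fibre_eq_empty (o : Fin n) (B : Finset (Fin n)) (hoB : o ∈ B) :
    (fun ω : BondConfig (Fin n) => Finset.univ.filter fun y : Fin n => y ≠ o ∧ s(o, y) ∈ ω) ⁻¹' {B} =
      ∅ := by
  ext ω
  simp only [Set.mem_preimage, Set.mem_singleton_iff, Set.mem_empty_iff_false, iff_false]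
  intro h
  rw [← h] at hoB
  simp at hoB

/-- The fibre over `∅` is `σ_∅`. [folklore] -/
theorem goodBase_fibre_empty (o : Fin n) :
    (fun ω : BondConfig (Fin n) => Finset.univ.filter fun y : Fin n => y ≠ o ∧ s(o, y) ∈ ω) ⁻¹' {∅} =
      {ω : BondConfig (Fin n) | ∀ y : Fin n, y ≠ o → s(o, y) ∉ ω} := by
  rw [goodBase_fibre_eq o ∅ (Finset.notMem_empty o)]
  ext ω
  simp

/-- **Termwise Lemma 5** on the fibres `B ≠ ∅`, given KN Lemma 5 (`h5`, σ_B form, any relay):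
`μ(σ_B ∩ {a₀ ↔ b}) ≤ μ(σ_B ∩ {o ↔ b})` for the `τ°`-minimiser `a₀` over `A`, when every pair
`s(o, y)`, `y ∉ A`, `y ≠ o`, has weight `0` (fibres avoiding `A` are null; fibres over `B ∋ o`
are empty). (Kozma–Nitzan arXiv:2401.12397, proof of Thm 4 p. 13.) -/
theorem goodBase_term_le (w : Sym2 (Fin n) → unitInterval) (A B : Finset (Fin n)) (o b a₀ : Fin n)
    (h5 : ∀ (a v : Fin n) (B : Finset (Fin n)), b ≠ o → a ≠ o → o ∉ B → v ∈ B →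
      (prodBernoulli w).real (openConnIn (({o} : Set (Fin n))ᶜ) a b)
        ≤ (prodBernoulli w).real (openConnIn (({o} : Set (Fin n))ᶜ) v b) →
      (prodBernoulli w).real
          ({ω : BondConfig (Fin n) | ∀ y : Fin n, y ≠ o → (s(o, y) ∈ ω ↔ y ∈ B)} ∩ openConn a b)
        ≤ (prodBernoulli w).real
          ({ω : BondConfig (Fin n) | ∀ y : Fin n, y ≠ o → (s(o, y) ∈ ω ↔ y ∈ B)} ∩ openConn o b))
    (hbo : b ≠ o) (ha₀o : a₀ ≠ o)
    (hmin : ∀ v ∈ A, (prodBernoulli w).real (openConnIn (({o} : Set (Fin n))ᶜ) a₀ b)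
      ≤ (prodBernoulli w).real (openConnIn (({o} : Set (Fin n))ᶜ) v b))
    (hiso : ∀ y : Fin n, y ∉ A → y ≠ o → w s(o, y) = 0) (hB : B ≠ ∅) :
    (prodBernoulli w).real
        ((fun ω : BondConfig (Fin n) => Finset.univ.filter fun y : Fin n => y ≠ o ∧ s(o, y) ∈ ω) ⁻¹' {B}
          ∩ openConn a₀ b) ≤
      (prodBernoulli w).real
        ((fun ω : BondConfig (Fin n) => Finset.univ.filter fun y : Fin n => y ≠ o ∧ s(o, y) ∈ ω) ⁻¹' {B}
          ∩ openConn o b) := by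
  by_cases hoB : o ∈ B
  · simp [goodBase_fibre_eq_empty o B hoB]
  rw [goodBase_fibre_eq o B hoB]
  by_cases hBA : (B ∩ A).Nonempty
  · obtain ⟨v, hv⟩ := hBA
    rw [Finset.mem_inter] at hv
    exact h5 a₀ v B hbo ha₀o hoB hv.1 (hmin v hv.2)
  · obtain ⟨y, hyB⟩ := Finset.nonempty_iff_ne_empty.2 hB
    have hyA : y ∉ A := fun h => hBA ⟨y, Finset.mem_inter.2 ⟨hyB, h⟩⟩
    have hyo : y ≠ o := fun h => hoB (h ▸ hyB)
    have hnull : (prodBernoulli w).real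
        {ω : BondConfig (Fin n) | ∀ y : Fin n, y ≠ o → (s(o, y) ∈ ω ↔ y ∈ B)} = 0 :=
      sigmaRec_null w _ {s(o, y)} (fun e he => by rw [Finset.mem_singleton.1 he]; exact hiso y hyA hyo)
        fun ω hω => ⟨s(o, y), Finset.mem_singleton_self _, (hω y hyo).2 hyB⟩
    rw [measureReal_mono_null Set.inter_subset_left hnull]
    exact measureReal_nonneg

/-- Summation bookkeeping: compare two sums over all `B` termwise off `B = ∅`, with an extra
allowance `c` for the `∅`-term. [folklore] -/
theorem goodBase_sum_le (g₁ g₂ : Finset (Fin n) → ℝ) (c : ℝ) (h₀ : g₁ ∅ ≤ c) (hnn : 0 ≤ g₂ ∅)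
    (hB : ∀ B : Finset (Fin n), B ≠ ∅ → g₁ B ≤ g₂ B) :
    ∑ B, g₁ B ≤ ∑ B, g₂ B + c := by
  rw [← Finset.add_sum_erase _ g₁ (Finset.mem_univ ∅), ← Finset.add_sum_erase _ g₂ (Finset.mem_univ ∅)]
  have h : ∑ B ∈ Finset.univ.erase (∅ : Finset (Fin n)), g₁ B ≤ ∑ B ∈ Finset.univ.erase ∅, g₂ B :=
    Finset.sum_le_sum fun B hB' => hB B (Finset.ne_of_mem_erase hB')
  linarith

/-- **The relay comparison** (Kozma–Nitzan arXiv:2401.12397, proof of Thm 4 p. 13, summed form):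
for the `τ°`-minimiser `a₀ ∈ A`, `μ(a₀ ↔ b) ≤ μ(o ↔ b) + μ(σ_∅) · τ°(a₀)` — partition both
connection events by the open star of `o` (`sigmaRec_sum_preimage_inter`), compare termwise off
`B = ∅` (`goodBase_term_le`), and factorise the `∅`-term (`goodBase_real_isolated_inter_openConn`). -/
theorem goodBase_relay_le (w : Sym2 (Fin n) → unitInterval) (A : Finset (Fin n)) (o b a₀ : Fin n)
    (h5 : ∀ (a v : Fin n) (B : Finset (Fin n)), b ≠ o → a ≠ o → o ∉ B → v ∈ B →
      (prodBernoulli w).real (openConnIn (({o} : Set (Fin n))ᶜ) a b)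
        ≤ (prodBernoulli w).real (openConnIn (({o} : Set (Fin n))ᶜ) v b) →
      (prodBernoulli w).real
          ({ω : BondConfig (Fin n) | ∀ y : Fin n, y ≠ o → (s(o, y) ∈ ω ↔ y ∈ B)} ∩ openConn a b)
        ≤ (prodBernoulli w).real
          ({ω : BondConfig (Fin n) | ∀ y : Fin n, y ≠ o → (s(o, y) ∈ ω ↔ y ∈ B)} ∩ openConn o b))
    (hbo : b ≠ o) (ha₀o : a₀ ≠ o)
    (hmin : ∀ v ∈ A, (prodBernoulli w).real (openConnIn (({o} : Set (Fin n))ᶜ) a₀ b)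
      ≤ (prodBernoulli w).real (openConnIn (({o} : Set (Fin n))ᶜ) v b))
    (hiso : ∀ y : Fin n, y ∉ A → y ≠ o → w s(o, y) = 0) :
    (prodBernoulli w).real (openConn a₀ b) ≤ (prodBernoulli w).real (openConn o b) +
      (prodBernoulli w).real {ω : BondConfig (Fin n) | ∀ y : Fin n, y ≠ o → s(o, y) ∉ ω} *
        (prodBernoulli w).real (openConnIn (({o} : Set (Fin n))ᶜ) a₀ b) := by
  have h1 := sigmaRec_sum_preimage_inter w
    (fun ω : BondConfig (Fin n) => Finset.univ.filter fun y : Fin n => y ≠ o ∧ s(o, y) ∈ ω)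
    (openConn a₀ b)
  have h2 := sigmaRec_sum_preimage_inter w
    (fun ω : BondConfig (Fin n) => Finset.univ.filter fun y : Fin n => y ≠ o ∧ s(o, y) ∈ ω)
    (openConn o b)
  have h0 : (prodBernoulli w).real
      ((fun ω : BondConfig (Fin n) => Finset.univ.filter fun y : Fin n => y ≠ o ∧ s(o, y) ∈ ω) ⁻¹' {∅}
        ∩ openConn a₀ b) =
      (prodBernoulli w).real {ω : BondConfig (Fin n) | ∀ y : Fin n, y ≠ o → s(o, y) ∉ ω} *
        (prodBernoulli w).real (openConnIn (({o} : Set (Fin n))ᶜ) a₀ b) := by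
    rw [goodBase_fibre_empty, goodBase_real_isolated_inter_openConn w o a₀ b ha₀o]
  rw [← h1, ← h2]
  exact goodBase_sum_le _ _ _ h0.le measureReal_nonneg fun B hB =>
    goodBase_term_le w A B o b a₀ h5 hbo ha₀o hmin hiso hB

/-- **stub_goodBase — goodness when the observer is isolated in `G ∖ A`, given Lemma 5**
(Kozma–Nitzan arXiv:2401.12397, Theorem 4 pp. 12–14, in the linear selection form of the line
`subuniform-dead-pocket-maximum`).  Assume KN Lemma 5 in `σ_B`-form for an arbitrary relay (the
displayed first hypothesis).  If `b ∈ A`, `o ∉ A` and every pair `s(o, y)` with `y ∉ A`, `y ≠ o`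
has weight `0`, then for every level `t` with `1 − t ≤ μ(a ↔ b)` on `A` and every selection
`sel W ∈ A`: `μ(o ↔ A, o ↮ b) + Σ_{W ∋ o, W ∩ A = ∅} μ(C(o) = W) · μ((sel W ↔ b in Wᶜ)ᶜ) ≤ t`.
Proof: with `a₀` the minimiser of `τ°(x) = μ(x ↔ b in {o}ᶜ)` over `A`, the live failure is
`μ(o ↔ A) − μ(o ↔ b) ≤ (1 − μ σ_∅) − μ(a₀ ↔ b) + μ(σ_∅) τ°(a₀) ≤ t − μ(σ_∅)(1 − τ°(a₀))`
(`goodBase_iUnion_subset_compl`, `goodBase_relay_le`, the relay hypothesis at `a₀`), while the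
only non-null dead pocket is `W = {o}` (`goodBase_cluster_null`), `{C(o) = {o}} ⊆ σ_∅`
(`goodBase_cluster_singleton_subset`) and `1 − τ°(sel {o}) ≤ 1 − τ°(a₀)`. -/
theorem stub_goodBase :
    (∀ (n : ℕ) (w : Sym2 (Fin n) → unitInterval) (o b a v : Fin n) (B : Finset (Fin n)),
      b ≠ o → a ≠ o → o ∉ B → v ∈ B →
      (prodBernoulli w).real (openConnIn (({o} : Set (Fin n))ᶜ) a b)
        ≤ (prodBernoulli w).real (openConnIn (({o} : Set (Fin n))ᶜ) v b) →
      (prodBernoulli w).real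
          ({ω : BondConfig (Fin n) | ∀ y : Fin n, y ≠ o → (s(o, y) ∈ ω ↔ y ∈ B)} ∩ openConn a b)
        ≤ (prodBernoulli w).real
          ({ω : BondConfig (Fin n) | ∀ y : Fin n, y ≠ o → (s(o, y) ∈ ω ↔ y ∈ B)} ∩ openConn o b)) →
    ∀ (n : ℕ) (w : Sym2 (Fin n) → unitInterval) (A : Finset (Fin n)) (o b : Fin n),
      b ∈ A → o ∉ A →
      (∀ y : Fin n, y ∉ A → y ≠ o → (w s(o, y) : ℝ) = 0) →
      ∀ (t : ℝ) (sel : Finset (Fin n) → Fin n), (∀ W, sel W ∈ A) →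
        (∀ a ∈ A, 1 - t ≤ (prodBernoulli w).real (openConn a b)) →
        (prodBernoulli w).real ((⋃ a ∈ A, openConn o a) ∩ (openConn o b)ᶜ)
          + ∑ W ∈ (Finset.univ : Finset (Finset (Fin n))).filter (fun W => o ∈ W ∧ Disjoint W A),
              (prodBernoulli w).real {ω : BondConfig (Fin n) | openCluster ω o = (W : Set (Fin n))}
                * (prodBernoulli w).real (openConnIn ((W : Set (Fin n))ᶜ) (sel W) b)ᶜ
          ≤ t := by
  intro h5 n w A o b hbA hoA hiso t sel hsel hrel
  have hbo : b ≠ o := fun h => hoA (h ▸ hbA)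
  have hiso' : ∀ y : Fin n, y ∉ A → y ≠ o → w s(o, y) = 0 := fun y hy hyo =>
    Set.Icc.coe_eq_zero.1 (hiso y hy hyo)
  -- the minimiser `a₀` of `τ°` over `A`
  obtain ⟨a₀, ha₀A, hmin⟩ := Finset.exists_min_image A
    (fun x => (prodBernoulli w).real (openConnIn (({o} : Set (Fin n))ᶜ) x b)) ⟨b, hbA⟩
  have ha₀o : a₀ ≠ o := fun h => hoA (h ▸ ha₀A)
  -- (3) the relay comparison and the relay hypothesis at `a₀`
  have h3 := goodBase_relay_le w A o b a₀ (h5 n w o b) hbo ha₀o hmin hiso'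
  have hrel₀ := hrel a₀ ha₀A
  -- (4) the live failure
  have hsub : (openConn o b : Set (BondConfig (Fin n))) ⊆ ⋃ a ∈ A, openConn o a := fun ω hω =>
    Set.mem_iUnion₂.2 ⟨b, hbA, hω⟩
  have hlive : (prodBernoulli w).real ((⋃ a ∈ A, openConn o a) ∩ (openConn o b)ᶜ) =
      (prodBernoulli w).real (⋃ a ∈ A, (openConn o a : Set (BondConfig (Fin n)))) -
        (prodBernoulli w).real (openConn o b) := by
    rw [← Set.sdiff_eq, measureReal_sdiff hsub (Set.toFinite _).measurableSet (measure_ne_top _ _)]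
  have hU : (prodBernoulli w).real (⋃ a ∈ A, (openConn o a : Set (BondConfig (Fin n)))) ≤
      1 - (prodBernoulli w).real {ω : BondConfig (Fin n) | ∀ y : Fin n, y ≠ o → s(o, y) ∉ ω} := by
    have h := measureReal_mono (μ := prodBernoulli w) (goodBase_iUnion_subset_compl A o hoA)
    rwa [probReal_compl_eq_one_sub (Set.toFinite _).measurableSet] at h
  -- (5) the penalty: only the pocket `{o}` survives
  have hmem : ({o} : Finset (Fin n)) ∈
      (Finset.univ : Finset (Finset (Fin n))).filter (fun W => o ∈ W ∧ Disjoint W A) :=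
    Finset.mem_filter.2 ⟨Finset.mem_univ _, Finset.mem_singleton_self o,
      Finset.disjoint_singleton_left.2 hoA⟩
  have hpen : ∑ W ∈ (Finset.univ : Finset (Finset (Fin n))).filter (fun W => o ∈ W ∧ Disjoint W A),
      (prodBernoulli w).real {ω : BondConfig (Fin n) | openCluster ω o = (W : Set (Fin n))}
        * (prodBernoulli w).real (openConnIn ((W : Set (Fin n))ᶜ) (sel W) b)ᶜ =
      (prodBernoulli w).real
          {ω : BondConfig (Fin n) | openCluster ω o = ((({o} : Finset (Fin n))) : Set (Fin n))} *
        (prodBernoulli w).real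
          (openConnIn (((({o} : Finset (Fin n))) : Set (Fin n)))ᶜ (sel {o}) b)ᶜ := by
    refine Finset.sum_eq_single_of_mem _ hmem fun W hW hWne => ?_
    rw [Finset.mem_filter] at hW
    rw [goodBase_cluster_null w A W o hiso' hW.2.2 hWne hW.2.1, zero_mul]
  have hC : (prodBernoulli w).real
      {ω : BondConfig (Fin n) | openCluster ω o = ((({o} : Finset (Fin n))) : Set (Fin n))} ≤
      (prodBernoulli w).real {ω : BondConfig (Fin n) | ∀ y : Fin n, y ≠ o → s(o, y) ∉ ω} :=
    measureReal_mono (goodBase_cluster_singleton_subset o)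
  have hfac : (prodBernoulli w).real
      (openConnIn (((({o} : Finset (Fin n))) : Set (Fin n)))ᶜ (sel {o}) b)ᶜ =
      1 - (prodBernoulli w).real (openConnIn (({o} : Set (Fin n)))ᶜ (sel {o}) b) := by
    rw [Finset.coe_singleton, probReal_compl_eq_one_sub (Set.toFinite _).measurableSet]
  have hminsel := hmin (sel {o}) (hsel {o})
  have hτ1 : (prodBernoulli w).real (openConnIn (({o} : Set (Fin n)))ᶜ (sel {o}) b) ≤ 1 :=
    measureReal_le_one
  have hEnn : 0 ≤ (prodBernoulli w).real
      {ω : BondConfig (Fin n) | ∀ y : Fin n, y ≠ o → s(o, y) ∉ ω} := measureReal_nonneg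
  have hCnn : 0 ≤ (prodBernoulli w).real
      {ω : BondConfig (Fin n) | openCluster ω o = ((({o} : Finset (Fin n))) : Set (Fin n))} :=
    measureReal_nonneg
  have hpen' : ∑ W ∈ (Finset.univ : Finset (Finset (Fin n))).filter (fun W => o ∈ W ∧ Disjoint W A),
      (prodBernoulli w).real {ω : BondConfig (Fin n) | openCluster ω o = (W : Set (Fin n))}
        * (prodBernoulli w).real (openConnIn ((W : Set (Fin n))ᶜ) (sel W) b)ᶜ ≤
      (prodBernoulli w).real {ω : BondConfig (Fin n) | ∀ y : Fin n, y ≠ o → s(o, y) ∉ ω} *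
        (1 - (prodBernoulli w).real (openConnIn (({o} : Set (Fin n)))ᶜ a₀ b)) := by
    rw [hpen, hfac]
    calc (prodBernoulli w).real
          {ω : BondConfig (Fin n) | openCluster ω o = ((({o} : Finset (Fin n))) : Set (Fin n))} *
            (1 - (prodBernoulli w).real (openConnIn (({o} : Set (Fin n)))ᶜ (sel {o}) b))
        ≤ (prodBernoulli w).real {ω : BondConfig (Fin n) | ∀ y : Fin n, y ≠ o → s(o, y) ∉ ω} *
            (1 - (prodBernoulli w).real (openConnIn (({o} : Set (Fin n)))ᶜ (sel {o}) b)) :=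
          mul_le_mul_of_nonneg_right hC (by linarith)
      _ ≤ (prodBernoulli w).real {ω : BondConfig (Fin n) | ∀ y : Fin n, y ≠ o → s(o, y) ∉ ω} *
            (1 - (prodBernoulli w).real (openConnIn (({o} : Set (Fin n)))ᶜ a₀ b)) :=
          mul_le_mul_of_nonneg_left (by linarith) hEnn
  -- (6) add up
  rw [hlive]
  nlinarith [h3, hrel₀, hU, hpen', hEnn]

end

end Summit.CriticalPhenomena.PercolationContinuityZ3.Theorems
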